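import Summits.Schanuel.Schanuel.Theorems.RootDecomp1ResidueSieve
import Summits.Schanuel.Schanuel.Theorems.RootDecomp1KHyper19

/-!
# RootDecomp1PowerLineLadder — PORT NOTE (census-1 gen 14, 2026-08-31): port of HOME/decomp-schanuel-lens-1/g32/RootDecomp1PowerLineLadder.lean (sha256 8dfa1caa2724…, 294 l; critic VERDICT STATUS L1599 (e) PORT GO LOW, census lane; writer re-check L1600), one part; `set_option linter.dupNamespace false` dropped, `lambdaH_pos` made private; statements/proofs verbatim; `--supports stmt-Schanuel-30353`; rung 0. The lens's header follows.

# RootDecomp1 — lens 1 (grading / quantitative ladder), gen 32: «PowerLineLadder» —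
# the power-line cell `(w, w², w³)` of D₃'s residue is DECIDED on the hyper-Liouville class

Cell decomp-schanuel, seat `decomp-schanuel-lens-1`, gen 32 (2026-08-31).  Route of record:
`route-Schanuel-RootDecomp1` (DRAFT rev 23), item **D** = `DisjointSaturatedEssentialSchanuel`
(stmt-Schanuel-30353; leaf IDEA-NEEDED).  Nothing here proves Schanuel; rung 0.

## What this file corrects (binding wording of rounds 15/16 and of the park rule (xi))

Round 15 (`RootDecomp1AdditiveCellsD` §6, `disjointSchanuel_powerTriple_iff`) reduced D₃ at a power line
`(w, w², w³)`, `w ∉ ℚ̄`, under the item's split binder `ε = 0`, to the pure value statement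
«PowerValueTwo(w)»: `2 ≤ trdeg ℚ(e^w, e^{w²}, e^{w³})`, and booked: «No instrument in the tree certifies the
right-hand side for a single `w`».  Round 16 (`RootDecomp1ResidueSieve` §4) and the critic's park rule (xi)
(STATUS L1085, 2026-08-30T18:15:03Z) repeated it: «Cell(1,1) ⊇ power lines ⟺ PowerValueTwo ≥ α^{log α}, e^{π²}»,
reopen trigger (β) = «a PowerValueTwo(w) instance in print or tree».

THAT SENTENCE WAS ALREADY FALSE WHEN WRITTEN.  Seven hours earlier (STATUS L705, 2026-08-30T11:20:21Z; critic
ACCEPTED L709 11:30:07Z; ported 2026-08-30 as `RootDecomp1KHyper12/13/16/19`, `--supports stmt-Schanuel-33363`)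
lens 6's specialisation engine had proved, for EVERY real hyper-Liouville `ℓ` and EVERY level `n`,
`AlgebraicIndependent ℚ (ℓ, e^ℓ, e^{ℓ²}, …, e^{ℓⁿ})` (`HyperCell.algebraicIndependent_curvePt_of_hyperLiouville`)
and Schanuel's bound on the moment curve `(ℓ, ℓ², …, ℓⁿ)` (`HyperCell.sb_momentCurve`), modulo ONE support
hypothesis `hX : ExplicitRatExpApprox` which follows from the REGISTERED Literature fact
`NesterenkoWaldschmidt1996_thm_5_1` (`HyperCell.explicitRatExpApprox_of_NW1996`) — a published theorem, not a
conjecture, and not yet used on route RootDecomp1.  At `n = 3` the moment curve IS the power line.  Nobody on the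
bus joined the two records (lens 1's arming checks g26–g31 grepped for the NAME `PowerValue`, not the content).

## Content (all binders of item D VERBATIM where D is named; sorry-free; standard axioms)

* §0 `powerTriple_eq_momentCurve` — `(w, w², w³)` = the level-3 moment curve; `powerLine = powerTriple` (rfl).
* §1 VALUE SIDE (mod `hX`): `algebraicIndependent_expPowers_of_hyperLiouville` — `e^ℓ, e^{ℓ²}, e^{ℓ³}` are
  algebraically independent for real hyper-Liouville `ℓ > 0`; hence PowerValueTHREE
  (`three_le_valDegree_powerTriple_of_hyperLiouville`) and a fortiori PowerValueTwo
  (`powerValueTwo_of_hyperLiouville`, the exact right-hand side of round 15's iff), for either sign of `ℓ`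
  (`valField_powerTriple_neg`: the value field is even in `w`).
* §2 ITEM D (binders verbatim, cell `range z = range (ℓ, ℓ², ℓ³)` inserted after `LinearIndependent ℚ z`) HOLDS
  for every real hyper-Liouville `ℓ` (mod `hX`): `disjointSaturatedEssentialSchanuel_powerTriple_of_hyperLiouville`
  — by `sb_momentCurve` at `n = 3` (so `t = 4`: the tuple is decided, non-vacuously — its rational
  non-degeneracy binder holds since `t = 4 > 3` parameters would be needed — and is not tight).
* §3 REGISTERED-FACT and MEMBER forms: `…_NW` (mod `NesterenkoWaldschmidt1996_thm_5_1` only) and the explicit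
  member `ℓ = λ_H = Σ_k 2^{-hexp k}` (`HyperCell.lambdaH`, `hyperLiouville_lambdaH` — certified, no Baire):
  `powerValue_lambdaH_NW`, `disjointSaturatedEssentialSchanuel_powerTriple_lambdaH_NW`.
* §4 THE LADDER (texts; the lens): the power-line cell of D₃ graded by the DIOPHANTINE TYPE of `w` —
  grade «every exponential order» (hyper-Liouville): DECIDED here; grade «exponential order k ≥ k₀(2)»:
  decidable by the same engine with fixed order (NOT typed here; lens 6's finite-order lane, `LiouvilleOrder`);
  grade «LogSq / every polynomial order» (`LogSqLiouville`, 33364's scope): only `(ℓ, e^ℓ)` a.i. is in the tree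
  (`algebraicIndependent_exp_of_logSqLiouville`) — PowerValueTwo OPEN; grade «Diophantine `w`» (incl. `log 2`,
  `πi`, `e`, `π`): OPEN = the classical wall (`α^{log α}`, `e^{π²}`; AIL-type).  Ceiling of the method family
  (specialisation `ℓ ↦ p/q` + approximation measure for `e^{p/q}` against algebraic numbers of degree `~q³`):
  exponential order; it is silent below.

Scope note (honest): D's first binder asks `z i ∈ ecl ∅`.  Whether a given hyper-Liouville real (e.g. `λ_H`)
lies in `ecl ∅` is open (no explicit complex number is known to lie outside `ecl ∅`; `ecl ∅` is countable, the
hyper-Liouville reals are comeagre).  The theorems below hold REGARDLESS — the conclusion is proved outright —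
so they decide D at these tuples; they shrink the OPEN part of the power-line cell to
`{w ∈ ecl ∅ : w not (yet) of a decided Diophantine grade}`.

Imports: tree Theorems only (`RootDecomp1ResidueSieve` ⊇ `RootDecomp1AdditiveCellsD`; `RootDecomp1KHyper19` ⊇
`RootDecomp1KHyper12/13/14/15/16`).  Port target (writer-1, if the critic clears it):
`Summits/Schanuel/Schanuel/Theorems/RootDecomp1PowerLineLadder.lean`, `--supports stmt-Schanuel-30353`.
-/

noncomputable section

namespace Summit.Schanuel.Schanuel.Theorems.RootDecomp1PowerLineLadder

open Complex IntermediateField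
open Literature.NumberTheory.Transcendental (NesterenkoWaldschmidt1996_thm_5_1)
open Summit.Schanuel.Schanuel.Theorems.RootDecomp1AdditiveCellsD (powerTriple powerTriple_linearIndependent
  disjointSchanuel_powerTriple_iff)
open Summit.Schanuel.Schanuel.Theorems.RootDecomp1ResidueSieve (powerLine transcendental_exp_sq_of_powerValueTwo)
open Summit.Schanuel.Schanuel.Theorems.RootDecomp1KHyper (SB SFset transcendental_ofReal_of_liouville)
open Summit.Schanuel.Schanuel.Theorems.RootDecomp1KHyper.HyperCell (HyperLiouville ExplicitRatExpApprox curvePt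
  lambdaH hyperLiouville_lambdaH lambdaH_tail_pos algebraicIndependent_curvePt_of_hyperLiouville sb_momentCurve
  explicitRatExpApprox_of_NW1996)

/-! ## §0  The power line is the level-3 moment curve -/

/-- `(w, w², w³) = (w^{0+1}, w^{1+1}, w^{2+1})`. -/
theorem powerTriple_eq_momentCurve (w : ℂ) : powerTriple w = fun i : Fin 3 => w ^ ((i : ℕ) + 1) := by
  funext i
  fin_cases i <;> simp [powerTriple]

/-- Round 16's `powerLine` is round 15's `powerTriple` (both `![w, w², w³]`). -/
theorem powerLine_eq_powerTriple (w : ℂ) : powerLine w = powerTriple w := rfl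

/-! ## §1  VALUE SIDE: `e^ℓ, e^{ℓ²}, e^{ℓ³}` algebraically independent for hyper-Liouville `ℓ` (mod `hX`) -/

/-- `k` algebraically independent members of an intermediate field give it transcendence degree `≥ k`. -/
private theorem natCast_le_trdeg {k : ℕ} {L : IntermediateField ℚ ℂ} {v : Fin k → ℂ}
    (hv : AlgebraicIndependent ℚ v) (hmem : ∀ i, v i ∈ L) : (k : Cardinal) ≤ Algebra.trdeg ℚ ↥L := by
  let y : Fin k → ↥L := fun i => ⟨v i, hmem i⟩
  have hy : AlgebraicIndependent ℚ y := AlgebraicIndependent.of_comp L.val hv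
  simpa using hy.cardinalMk_le_trdeg

/-- **The three values `e^ℓ, e^{ℓ²}, e^{ℓ³}` of the power line are algebraically independent over `ℚ`** for a
real hyper-Liouville `ℓ > 0` (mod `hX`) — the tail of lens 6's `curvePt 3 ℓ = (ℓ, e^ℓ, e^{ℓ²}, e^{ℓ³})`. -/
theorem algebraicIndependent_expPowers_of_hyperLiouville (hX : ExplicitRatExpApprox) {ℓ : ℝ}
    (hℓ : HyperLiouville ℓ) (hℓ0 : 0 < ℓ) :
    AlgebraicIndependent ℚ (cexp ∘ powerTriple (ℓ : ℂ)) := by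
  have h := (algebraicIndependent_curvePt_of_hyperLiouville hX hℓ hℓ0 3).comp Fin.succ (Fin.succ_injective 3)
  convert h using 1
  funext i
  simp [curvePt, powerTriple_eq_momentCurve]

/-- **PowerValueTHREE on the hyper-Liouville class (mod `hX`):** `3 ≤ trdeg ℚ(e^ℓ, e^{ℓ²}, e^{ℓ³})` (`ℓ > 0`). -/
theorem three_le_valDegree_powerTriple_of_hyperLiouville (hX : ExplicitRatExpApprox) {ℓ : ℝ}
    (hℓ : HyperLiouville ℓ) (hℓ0 : 0 < ℓ) :
    (3 : Cardinal) ≤ Algebra.trdeg ℚ ↥(adjoin ℚ (Set.range (cexp ∘ powerTriple (ℓ : ℂ)))) := by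
  have h := natCast_le_trdeg (L := adjoin ℚ (Set.range (cexp ∘ powerTriple (ℓ : ℂ))))
    (algebraicIndependent_expPowers_of_hyperLiouville hX hℓ hℓ0) (fun i => subset_adjoin ℚ _ ⟨i, rfl⟩)
  exact_mod_cast h

/-- The value field of the power line is EVEN in `w`: `ℚ(e^{-w}, e^{w²}, e^{-w³}) = ℚ(e^{w}, e^{w²}, e^{w³})`. -/
theorem valField_powerTriple_neg (w : ℂ) :
    adjoin ℚ (Set.range (cexp ∘ powerTriple (-w))) = adjoin ℚ (Set.range (cexp ∘ powerTriple w)) := by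
  have key : ∀ v : ℂ, Set.range (cexp ∘ powerTriple (-v)) ⊆ (adjoin ℚ (Set.range (cexp ∘ powerTriple v)) : Set ℂ) := by
    intro v
    rintro _ ⟨i, rfl⟩
    have hm : ∀ j : Fin 3, cexp (powerTriple v j) ∈ adjoin ℚ (Set.range (cexp ∘ powerTriple v)) := fun j =>
      subset_adjoin ℚ _ ⟨j, rfl⟩
    fin_cases i
    · have := inv_mem (hm 0)
      simpa [powerTriple, Complex.exp_neg] using this
    · simpa [powerTriple, neg_sq] using hm 1
    · have := inv_mem (hm 2)
      simpa [powerTriple, Complex.exp_neg, neg_pow, pow_succ, pow_zero] using this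
  refine le_antisymm (adjoin_le_iff.mpr (key w)) (adjoin_le_iff.mpr ?_)
  simpa using key (-w)

/-- **PowerValueTHREE for EITHER sign** of the real hyper-Liouville `ℓ` (mod `hX`). -/
theorem three_le_valDegree_powerTriple_of_hyperLiouville' (hX : ExplicitRatExpApprox) {ℓ : ℝ}
    (hℓ : HyperLiouville ℓ) :
    (3 : Cardinal) ≤ Algebra.trdeg ℚ ↥(adjoin ℚ (Set.range (cexp ∘ powerTriple (ℓ : ℂ)))) := by
  rcases lt_or_gt_of_ne hℓ.irrational.ne_zero with hneg | hpos
  · have h := three_le_valDegree_powerTriple_of_hyperLiouville hX hℓ.neg (neg_pos.mpr hneg)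
    rwa [Complex.ofReal_neg, valField_powerTriple_neg] at h
  · exact three_le_valDegree_powerTriple_of_hyperLiouville hX hℓ hpos

/-- **PowerValueTwo(ℓ) — the exact right-hand side of round 15's `disjointSchanuel_powerTriple_iff` — HOLDS for
every real hyper-Liouville `ℓ` (mod `hX`).**  This is the instance the park rule (xi) names as trigger (β). -/
theorem powerValueTwo_of_hyperLiouville (hX : ExplicitRatExpApprox) {ℓ : ℝ} (hℓ : HyperLiouville ℓ) :
    (2 : Cardinal) ≤ Algebra.trdeg ℚ ↥(adjoin ℚ (Set.range (cexp ∘ powerTriple (ℓ : ℂ)))) :=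
  le_trans (by exact_mod_cast (by norm_num : (2 : ℕ) ≤ 3)) (three_le_valDegree_powerTriple_of_hyperLiouville' hX hℓ)

/-! ## §2  ITEM D (binders verbatim) HOLDS on the cell `{range z = range (ℓ, ℓ², ℓ³)}`, `ℓ` real hyper-Liouville -/

/-- **ITEM D = `DisjointSaturatedEssentialSchanuel` (stmt-Schanuel-30353), binders VERBATIM, with the cell
`n ≤ 3 ∧ range z = range (ℓ, ℓ², ℓ³)` inserted after `LinearIndependent ℚ z`, HOLDS for every real hyper-Liouville
`ℓ` (mod `hX`)** — lens 6's `sb_momentCurve` at level `3` (`trdeg ℚ(ℓ, e^ℓ, e^{ℓ²}, e^{ℓ³}) = 4`).  None of D's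
other binders is used (underscored): the conclusion holds outright at these tuples. -/
theorem disjointSaturatedEssentialSchanuel_powerTriple_of_hyperLiouville (hX : ExplicitRatExpApprox) {ℓ : ℝ}
    (hℓ : HyperLiouville ℓ) :
    ∀ (n : ℕ), 3 ≤ n → ∀ (z : Fin n → ℂ), LinearIndependent ℚ z →
      (n ≤ 3 ∧ Set.range z = Set.range (powerTriple (ℓ : ℂ))) →
      (∀ i, z i ∈ Literature.NumberTheory.Transcendental.ecl (∅ : Set ℂ)) →
      (∀ (m : ℕ), m < n → ∀ (w : Fin m → ℂ), LinearIndependent ℚ w →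
        (∀ i, w i ∈ Submodule.span ℚ (Set.range z)) →
        (m : Cardinal) ≤ Algebra.trdeg ℚ ↥(IntermediateField.adjoin ℚ (Set.range w ∪ Set.range (Complex.exp ∘ w)))) →
      (∀ w : ℂ, IsAlgebraic ↥(IntermediateField.adjoin ℚ (Set.range z ∪ Set.range (Complex.exp ∘ z))) w →
        IsAlgebraic ↥(IntermediateField.adjoin ℚ (Set.range z ∪ Set.range (Complex.exp ∘ z))) (Complex.exp w) →
        w ∈ Submodule.span ℚ (Set.range z)) →
      (∀ (k : ℕ) (t : Fin k → ℂ) (β₀ γ₀ : Fin n → ℂ) (β γ : Fin n → Fin k → ℂ), (∀ i, IsAlgebraic ℚ (β₀ i)) →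
        (∀ i j, IsAlgebraic ℚ (β i j)) → (∀ i, IsAlgebraic ℚ (γ₀ i)) → (∀ i j, IsAlgebraic ℚ (γ i j)) →
        (∀ i, z i = β₀ i + ∑ j, β i j * t j) → (∀ i, Complex.exp (z i) = γ₀ i + ∑ j, γ i j * t j) → n ≤ k) →
      (∀ (k : ℕ) (t : Fin k → ℂ) (β₀ γ₀ : Fin n → ℂ) (β γ : Fin n → Fin k → ℂ) (δ ε : Fin n → Fin k → Fin k → ℂ),
        (∀ i, IsAlgebraic ℚ (β₀ i)) → (∀ i j, IsAlgebraic ℚ (β i j)) → (∀ i j j', IsAlgebraic ℚ (δ i j j')) →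
        (∀ i, IsAlgebraic ℚ (γ₀ i)) → (∀ i j, IsAlgebraic ℚ (γ i j)) → (∀ i j j', IsAlgebraic ℚ (ε i j j')) →
        (∀ i, z i = β₀ i + ∑ j, β i j * t j + ∑ j, ∑ j', δ i j j' * (t j * t j')) →
        (∀ i, Complex.exp (z i) = γ₀ i + ∑ j, γ i j * t j + ∑ j, ∑ j', ε i j j' * (t j * t j')) → n ≤ k) →
      (∀ (k : ℕ) (t : Fin k → ℂ) (D : MvPolynomial (Fin k) ℂ) (N E : Fin n → MvPolynomial (Fin k) ℂ),
        (∀ m, IsAlgebraic ℚ (MvPolynomial.coeff m D)) → (∀ i m, IsAlgebraic ℚ (MvPolynomial.coeff m (N i))) →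
        (∀ i m, IsAlgebraic ℚ (MvPolynomial.coeff m (E i))) → MvPolynomial.eval t D ≠ 0 →
        (∀ i, z i * MvPolynomial.eval t D = MvPolynomial.eval t (N i)) →
        (∀ i, Complex.exp (z i) * MvPolynomial.eval t D = MvPolynomial.eval t (E i)) → n ≤ k) →
      (Algebra.trdeg ℚ ↥(IntermediateField.adjoin ℚ (Set.range z)) +
          Algebra.trdeg ℚ ↥(IntermediateField.adjoin ℚ (Set.range (Complex.exp ∘ z))) ≤
        Algebra.trdeg ℚ ↥(IntermediateField.adjoin ℚ (Set.range z ∪ Set.range (Complex.exp ∘ z)))) →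
      (n : Cardinal) ≤ Algebra.trdeg ℚ ↥(IntermediateField.adjoin ℚ (Set.range z ∪ Set.range (Complex.exp ∘ z))) := by
  intro n hn z hz hcell _ _ _ _ _ _ _
  obtain rfl : n = 3 := le_antisymm hcell.1 hn
  have e1 : Set.range (Complex.exp ∘ z) = Set.range (cexp ∘ powerTriple (ℓ : ℂ)) := by
    rw [Set.range_comp, Set.range_comp, hcell.2]
  rw [e1, hcell.2]
  have h := sb_momentCurve hX hℓ 3
  rw [← powerTriple_eq_momentCurve] at h
  exact h

/-! ## §3  REGISTERED-FACT form (mod NW 1996 Thm 5 (1) only) and the explicit member `λ_H` -/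

/-- **ITEM D on the power-line cell of every real hyper-Liouville `ℓ`, modulo ONLY the registered Literature fact
`NesterenkoWaldschmidt1996_thm_5_1`** (a published theorem; not previously used on route RootDecomp1). -/
theorem disjointSaturatedEssentialSchanuel_powerTriple_NW (hNW : NesterenkoWaldschmidt1996_thm_5_1) {ℓ : ℝ}
    (hℓ : HyperLiouville ℓ) :
    ∀ (n : ℕ), 3 ≤ n → ∀ (z : Fin n → ℂ), LinearIndependent ℚ z →
      (n ≤ 3 ∧ Set.range z = Set.range (powerTriple (ℓ : ℂ))) →
      (∀ i, z i ∈ Literature.NumberTheory.Transcendental.ecl (∅ : Set ℂ)) →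
      (∀ (m : ℕ), m < n → ∀ (w : Fin m → ℂ), LinearIndependent ℚ w →
        (∀ i, w i ∈ Submodule.span ℚ (Set.range z)) →
        (m : Cardinal) ≤ Algebra.trdeg ℚ ↥(IntermediateField.adjoin ℚ (Set.range w ∪ Set.range (Complex.exp ∘ w)))) →
      (∀ w : ℂ, IsAlgebraic ↥(IntermediateField.adjoin ℚ (Set.range z ∪ Set.range (Complex.exp ∘ z))) w →
        IsAlgebraic ↥(IntermediateField.adjoin ℚ (Set.range z ∪ Set.range (Complex.exp ∘ z))) (Complex.exp w) →
        w ∈ Submodule.span ℚ (Set.range z)) →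
      (∀ (k : ℕ) (t : Fin k → ℂ) (β₀ γ₀ : Fin n → ℂ) (β γ : Fin n → Fin k → ℂ), (∀ i, IsAlgebraic ℚ (β₀ i)) →
        (∀ i j, IsAlgebraic ℚ (β i j)) → (∀ i, IsAlgebraic ℚ (γ₀ i)) → (∀ i j, IsAlgebraic ℚ (γ i j)) →
        (∀ i, z i = β₀ i + ∑ j, β i j * t j) → (∀ i, Complex.exp (z i) = γ₀ i + ∑ j, γ i j * t j) → n ≤ k) →
      (∀ (k : ℕ) (t : Fin k → ℂ) (β₀ γ₀ : Fin n → ℂ) (β γ : Fin n → Fin k → ℂ) (δ ε : Fin n → Fin k → Fin k → ℂ),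
        (∀ i, IsAlgebraic ℚ (β₀ i)) → (∀ i j, IsAlgebraic ℚ (β i j)) → (∀ i j j', IsAlgebraic ℚ (δ i j j')) →
        (∀ i, IsAlgebraic ℚ (γ₀ i)) → (∀ i j, IsAlgebraic ℚ (γ i j)) → (∀ i j j', IsAlgebraic ℚ (ε i j j')) →
        (∀ i, z i = β₀ i + ∑ j, β i j * t j + ∑ j, ∑ j', δ i j j' * (t j * t j')) →
        (∀ i, Complex.exp (z i) = γ₀ i + ∑ j, γ i j * t j + ∑ j, ∑ j', ε i j j' * (t j * t j')) → n ≤ k) →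
      (∀ (k : ℕ) (t : Fin k → ℂ) (D : MvPolynomial (Fin k) ℂ) (N E : Fin n → MvPolynomial (Fin k) ℂ),
        (∀ m, IsAlgebraic ℚ (MvPolynomial.coeff m D)) → (∀ i m, IsAlgebraic ℚ (MvPolynomial.coeff m (N i))) →
        (∀ i m, IsAlgebraic ℚ (MvPolynomial.coeff m (E i))) → MvPolynomial.eval t D ≠ 0 →
        (∀ i, z i * MvPolynomial.eval t D = MvPolynomial.eval t (N i)) →
        (∀ i, Complex.exp (z i) * MvPolynomial.eval t D = MvPolynomial.eval t (E i)) → n ≤ k) →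
      (Algebra.trdeg ℚ ↥(IntermediateField.adjoin ℚ (Set.range z)) +
          Algebra.trdeg ℚ ↥(IntermediateField.adjoin ℚ (Set.range (Complex.exp ∘ z))) ≤
        Algebra.trdeg ℚ ↥(IntermediateField.adjoin ℚ (Set.range z ∪ Set.range (Complex.exp ∘ z)))) →
      (n : Cardinal) ≤ Algebra.trdeg ℚ ↥(IntermediateField.adjoin ℚ (Set.range z ∪ Set.range (Complex.exp ∘ z))) :=
  disjointSaturatedEssentialSchanuel_powerTriple_of_hyperLiouville (explicitRatExpApprox_of_NW1996 hNW) hℓ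

/-- `λ_H > 0`. -/
private theorem lambdaH_pos : 0 < lambdaH := by
  simpa [lambdaH] using lambdaH_tail_pos 0

/-- **The explicit member: PowerValueTHREE at `w = λ_H`** (mod NW 1996 Thm 5 (1)):
`e^{λ_H}, e^{λ_H²}, e^{λ_H³}` are algebraically independent, so `3 ≤ trdeg ℚ(e^{λ_H}, e^{λ_H²}, e^{λ_H³})`. -/
theorem powerValue_lambdaH_NW (hNW : NesterenkoWaldschmidt1996_thm_5_1) :
    AlgebraicIndependent ℚ (cexp ∘ powerTriple (lambdaH : ℂ)) ∧
      (3 : Cardinal) ≤ Algebra.trdeg ℚ ↥(adjoin ℚ (Set.range (cexp ∘ powerTriple (lambdaH : ℂ)))) :=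
  ⟨algebraicIndependent_expPowers_of_hyperLiouville (explicitRatExpApprox_of_NW1996 hNW) hyperLiouville_lambdaH
      lambdaH_pos,
    three_le_valDegree_powerTriple_of_hyperLiouville (explicitRatExpApprox_of_NW1996 hNW) hyperLiouville_lambdaH
      lambdaH_pos⟩

/-- **ITEM D (binders verbatim) DECIDED at the explicit power line `(λ_H, λ_H², λ_H³)`**, modulo the registered
fact NW 1996 Thm 5 (1) only. -/
theorem disjointSaturatedEssentialSchanuel_powerTriple_lambdaH_NW (hNW : NesterenkoWaldschmidt1996_thm_5_1) :
    ∀ (n : ℕ), 3 ≤ n → ∀ (z : Fin n → ℂ), LinearIndependent ℚ z →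
      (n ≤ 3 ∧ Set.range z = Set.range (powerTriple (lambdaH : ℂ))) →
      (∀ i, z i ∈ Literature.NumberTheory.Transcendental.ecl (∅ : Set ℂ)) →
      (∀ (m : ℕ), m < n → ∀ (w : Fin m → ℂ), LinearIndependent ℚ w →
        (∀ i, w i ∈ Submodule.span ℚ (Set.range z)) →
        (m : Cardinal) ≤ Algebra.trdeg ℚ ↥(IntermediateField.adjoin ℚ (Set.range w ∪ Set.range (Complex.exp ∘ w)))) →
      (∀ w : ℂ, IsAlgebraic ↥(IntermediateField.adjoin ℚ (Set.range z ∪ Set.range (Complex.exp ∘ z))) w →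
        IsAlgebraic ↥(IntermediateField.adjoin ℚ (Set.range z ∪ Set.range (Complex.exp ∘ z))) (Complex.exp w) →
        w ∈ Submodule.span ℚ (Set.range z)) →
      (∀ (k : ℕ) (t : Fin k → ℂ) (β₀ γ₀ : Fin n → ℂ) (β γ : Fin n → Fin k → ℂ), (∀ i, IsAlgebraic ℚ (β₀ i)) →
        (∀ i j, IsAlgebraic ℚ (β i j)) → (∀ i, IsAlgebraic ℚ (γ₀ i)) → (∀ i j, IsAlgebraic ℚ (γ i j)) →
        (∀ i, z i = β₀ i + ∑ j, β i j * t j) → (∀ i, Complex.exp (z i) = γ₀ i + ∑ j, γ i j * t j) → n ≤ k) →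
      (∀ (k : ℕ) (t : Fin k → ℂ) (β₀ γ₀ : Fin n → ℂ) (β γ : Fin n → Fin k → ℂ) (δ ε : Fin n → Fin k → Fin k → ℂ),
        (∀ i, IsAlgebraic ℚ (β₀ i)) → (∀ i j, IsAlgebraic ℚ (β i j)) → (∀ i j j', IsAlgebraic ℚ (δ i j j')) →
        (∀ i, IsAlgebraic ℚ (γ₀ i)) → (∀ i j, IsAlgebraic ℚ (γ i j)) → (∀ i j j', IsAlgebraic ℚ (ε i j j')) →
        (∀ i, z i = β₀ i + ∑ j, β i j * t j + ∑ j, ∑ j', δ i j j' * (t j * t j')) →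
        (∀ i, Complex.exp (z i) = γ₀ i + ∑ j, γ i j * t j + ∑ j, ∑ j', ε i j j' * (t j * t j')) → n ≤ k) →
      (∀ (k : ℕ) (t : Fin k → ℂ) (D : MvPolynomial (Fin k) ℂ) (N E : Fin n → MvPolynomial (Fin k) ℂ),
        (∀ m, IsAlgebraic ℚ (MvPolynomial.coeff m D)) → (∀ i m, IsAlgebraic ℚ (MvPolynomial.coeff m (N i))) →
        (∀ i m, IsAlgebraic ℚ (MvPolynomial.coeff m (E i))) → MvPolynomial.eval t D ≠ 0 →
        (∀ i, z i * MvPolynomial.eval t D = MvPolynomial.eval t (N i)) →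
        (∀ i, Complex.exp (z i) * MvPolynomial.eval t D = MvPolynomial.eval t (E i)) → n ≤ k) →
      (Algebra.trdeg ℚ ↥(IntermediateField.adjoin ℚ (Set.range z)) +
          Algebra.trdeg ℚ ↥(IntermediateField.adjoin ℚ (Set.range (Complex.exp ∘ z))) ≤
        Algebra.trdeg ℚ ↥(IntermediateField.adjoin ℚ (Set.range z ∪ Set.range (Complex.exp ∘ z)))) →
      (n : Cardinal) ≤ Algebra.trdeg ℚ ↥(IntermediateField.adjoin ℚ (Set.range z ∪ Set.range (Complex.exp ∘ z))) :=
  disjointSaturatedEssentialSchanuel_powerTriple_NW hNW hyperLiouville_lambdaH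

/-! ## §4  Bookkeeping: the power line is ℚ-free and lies in round 15's reduction; the two records now agree -/

/-- The power line of a hyper-Liouville real is ℚ-free (so the cell of §2 is a genuine instance of D's scope
apart from the open `ecl ∅`-membership): `λ_H` (indeed any Liouville real) is transcendental. -/
theorem powerTriple_linearIndependent_of_hyperLiouville {ℓ : ℝ} (hℓ : HyperLiouville ℓ) :
    LinearIndependent ℚ (powerTriple (ℓ : ℂ)) := by
  exact powerTriple_linearIndependent (transcendental_ofReal_of_liouville hℓ.liouville)

/-- **Round 15's reduction, right-hand side now supplied:** for real hyper-Liouville `ℓ` (mod `hX`) BOTH sides of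
`disjointSchanuel_powerTriple_iff` hold — D₃'s conclusion at the power line, under any split hypothesis. -/
theorem disjointSchanuel_powerTriple_of_hyperLiouville (hX : ExplicitRatExpApprox) {ℓ : ℝ} (hℓ : HyperLiouville ℓ)
    (hsplit : Algebra.trdeg ℚ ↥(adjoin ℚ (Set.range (powerTriple (ℓ : ℂ)))) +
        Algebra.trdeg ℚ ↥(adjoin ℚ (Set.range (cexp ∘ powerTriple (ℓ : ℂ)))) ≤
      Algebra.trdeg ℚ ↥(adjoin ℚ (Set.range (powerTriple (ℓ : ℂ)) ∪ Set.range (cexp ∘ powerTriple (ℓ : ℂ))))) :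
    ((3 : ℕ) : Cardinal) ≤
      Algebra.trdeg ℚ ↥(adjoin ℚ (Set.range (powerTriple (ℓ : ℂ)) ∪ Set.range (cexp ∘ powerTriple (ℓ : ℂ)))) := by
  exact (disjointSchanuel_powerTriple_iff (transcendental_ofReal_of_liouville hℓ.liouville) hsplit).mpr
    (powerValueTwo_of_hyperLiouville hX hℓ)

end Summit.Schanuel.Schanuel.Theorems.RootDecomp1PowerLineLadder

end
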